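import Literature.Analysis.FluidPDE.NSCriticalClosureBesovPathSpace
import HarnessLib

/-!
# The critical Besov continuation criterion from the faithful forms of GKP Thm. 1 / Albritton Thm. 1.1

Analysis/FluidPDE assembly file (proofs only: no definition, no named fact, no statement of the
tree is changed) for the named fact
`Literature.Analysis.FluidPDE.hasSmoothExtensionPast_of_eHomBesovNorm_bounded`
(`NSCriticalClosure.lean`; Gallagher–Koch–Planchon 2016, Thm. 1, contrapositive for classical
Leray–Hopf solutions from rapidly decaying data: a classical Leray–Hopf solution on `[0, T)` whose
critical Besov norm `‖u(t)‖_{Ḃ^{-1+3/r}_{r,q}}`, `3 < r, q < ∞`, stays bounded extends smoothly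
past `T`).

Since the verdict clean-up of 2026-08-15 (`CriticalRegularity.lean`, §"Verdict clean-up") the
tree-class renderings `gkp_besov_blowup` / `albritton_besov_blowup` of GKP's Theorem 1 and
Albritton's Theorem 1.1 are deprecated (mis-stated over the tree's class
`IsMaximalBesovMildSolution`), and the **faithful statements** are read over Gallagher–Koch–
Planchon's own solution class `IsMaximalGKPSolution p q T ν u U` (`GKPCriticalElements.lean`: a
Besov mild solution of the critical class `(s_p, p, q)` on `[0, T)` lying in the path space
`𝓛^{1:∞}_{p,q}[T' < T]`, with no such solution on a longer interval extending it). They are displayed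
there as the wanted named facts

    gkp_besov_blowup_pathSpace       -- [cite: GKP2016, Thm. 1]
    albritton_besov_blowup_pathSpace -- [cite: Albritton2018, Thm. 1.1]

(verbatim the hypothesis `hT1` of `gkp_rigidity_pathSpace_of_blowup_pathSpace`, resp. its
`Tendsto … (𝓝 ∞)` strengthening), to be declared by a definition/cite item.

This file records, once and for all, that **either faithful statement implies the continuation
criterion**, with every other input a theorem of the tree:

* `hasSmoothExtensionPast_of_eHomBesovNorm_bounded_of_gkp_besov_blowup_pathSpace (hG) : _` —
  `hG` is *exactly* the displayed statement of `gkp_besov_blowup_pathSpace` (GKP Thm. 1 over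
  `IsMaximalGKPSolution`, all `3 < p, q < ∞`, every viscosity `ν > 0`, `limsup` form);
* `hasSmoothExtensionPast_of_eHomBesovNorm_bounded_of_albritton_besov_blowup_pathSpace (hA) : _` —
  `hA` is *exactly* the displayed statement of `albritton_besov_blowup_pathSpace` (the limit form).

So the discharge of the criterion is the one-liner
`…_of_gkp_besov_blowup_pathSpace gkp_besov_blowup_pathSpace_holds` (or the Albritton variant) the
moment either faithful fact is declared and proved; no identification hypothesis `hId` of the
tree's class with `NS(u₀)` is involved.

The proofs are re-packagings of `hasSmoothExtensionPast_of_eHomBesovNorm_bounded_of_gkpThm1_pathSpace`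
(`NSCriticalClosureBesovPathSpace.lean`), which takes Thm. 1 over the path space in unfolded form
(`IsBesovMildSolutionOn ∧ MemGKPPathSpace`, no extension in that class) and only for the GKP
exponents `p = q = 3·2^k - 2`: a classical Leray–Hopf solution from a rapidly decaying datum is a
GKP solution of every class `(s_p, p, p)`, `p ≥ 2` (`memGKPPathSpace_of_classical`, Tao 2013 +
Littlewood–Paley), it is maximal in GKP's class when it does not extend (KNSS 2009 smoothing of a
bounded extension, `knss2009_local_smoothing_holds`), and its `(s_p, p, p)` norm is bounded by the
`(s_r, r, q)` norm for `p ≥ max(r, q)` (Besov embedding (1.1), `besov_embedding_holds`).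
`IsMaximalGKPSolution` is literally that unfolded form (`IsGKPSolutionOn = ⟨IsBesovMildSolutionOn,
MemGKPPathSpace unfolded⟩`, `memGKPPathSpace_iff = Iff.rfl`), and `Tendsto … (𝓝 ∞)` along the
non-trivial filter `𝓝[<] T` gives `limsup = ∞` (`Tendsto.limsup_eq`).

## References

* I. Gallagher, G. S. Koch, F. Planchon, *Blow-up of critical Besov norms at a potential
  Navier–Stokes singularity*, Comm. Math. Phys. 343 (2016) 39–82 = arXiv:1407.4156: Thm. 1 (p. 5),
  (1.3), (1.6), Rem. 1.3 (p. 4), §2.1 (p. 6). [GKP2016]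
* D. Albritton, *Blow-up criteria for the Navier–Stokes equations in non-endpoint critical Besov
  spaces*, Anal. PDE 11 (2018) 1415–1456 = arXiv:1612.04439: Thm. 1.1, Thm. 4.2. [Albritton2018]
-/

noncomputable section

open MeasureTheory TemperedDistribution Set Function Filter
open _root_.Topology
open scoped SchwartzMap ENNReal NNReal

namespace Literature.Analysis.FluidPDE

/-- **The continuation criterion from GKP's Theorem 1 in its faithful form.** Hypothesis `hG` is,
verbatim, the wanted named fact `gkp_besov_blowup_pathSpace` of `CriticalRegularity.lean`
(§"Verdict clean-up", = hypothesis `hT1` of `gkp_rigidity_pathSpace_of_blowup_pathSpace`):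
Gallagher–Koch–Planchon 2016, Thm. 1 — for every viscosity `ν > 0`, all `3 < p, q < ∞` and
`0 < T`, every maximal GKP solution `(u, U)` of the class `(s_p, p, q)` with lifespan `T`
(`IsMaximalGKPSolution p q T ν u U`: `NS(u₀)` on `[0, T*)`, `T* = T < ∞`, in the path space
`𝓛^{1:∞}_{p,q}[T' < T*]`) has `limsup_{t → T⁻} ‖U t‖_{Ḃ^{s_p}_{p,q}} = ∞`. **Conclusion:** the
continuation criterion `hasSmoothExtensionPast_of_eHomBesovNorm_bounded`; every other input is a
theorem of the tree (via `hasSmoothExtensionPast_of_eHomBesovNorm_bounded_of_gkpThm1_pathSpace`,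
used only on the diagonal `p = q = 3·2^k - 2`). [cite: GKP2016, Thm. 1] -/
theorem hasSmoothExtensionPast_of_eHomBesovNorm_bounded_of_gkp_besov_blowup_pathSpace
    (hG : ∀ ⦃ν : ℝ⦄, 0 < ν → ∀ ⦃p q : ℝ≥0∞⦄ [Fact (1 ≤ p)], 3 < p → p < ∞ → 3 < q → q < ∞ →
      ∀ ⦃T : ℝ⦄, 0 < T → ∀ ⦃u : ℝ → EuclideanSpace ℝ (Fin 3) → EuclideanSpace ℝ (Fin 3)⦄
        ⦃U : ℝ → 𝓢'(EuclideanSpace ℝ (Fin 3), EuclideanSpace ℂ (Fin 3))⦄,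
        IsMaximalGKPSolution p q T ν u U →
          limsup (fun t => FunctionSpaces.eHomBesovNorm (-1 + 3 / p.toReal) p q (U t))
            (𝓝[<] T) = ∞) :
    hasSmoothExtensionPast_of_eHomBesovNorm_bounded :=
  hasSmoothExtensionPast_of_eHomBesovNorm_bounded_of_gkpThm1_pathSpace
    fun _ hν _ _ hp _ hT _ _ hB hPath hmax =>
      hG hν hp.three_lt hp.lt_top hp.three_lt hp.lt_top hT
        ⟨⟨hB, memGKPPathSpace_iff.1 hPath⟩, fun ⟨T', hT', v, V, hv, hvu⟩ =>
          hmax ⟨T', hT', v, V, ⟨hv.isBesovMildSolutionOn, memGKPPathSpace_iff.2 hv.pathNorm_lt_top⟩,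
            hvu⟩⟩

/-- **The continuation criterion from Albritton's Theorem 1.1 in its faithful form.** Hypothesis
`hA` is, verbatim, the wanted named fact `albritton_besov_blowup_pathSpace` of
`CriticalRegularity.lean` (§"Verdict clean-up"): Albritton 2018, Thm. 1.1 with Thm. 4.2 — for every
viscosity `ν > 0`, all `3 < p, q < ∞` and `0 < T`, every maximal GKP solution `(u, U)` of the class
`(s_p, p, q)` with lifespan `T` has `‖U t‖_{Ḃ^{s_p}_{p,q}} → ∞` as `t → T⁻`
(`Tendsto … (𝓝[<] T) (𝓝 ∞)`). It implies the `limsup` form along the non-trivial filter `𝓝[<] T`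
(`Tendsto.limsup_eq`), whence the criterion by
`hasSmoothExtensionPast_of_eHomBesovNorm_bounded_of_gkp_besov_blowup_pathSpace`.
[cite: Albritton2018, Thm. 1.1] -/
theorem hasSmoothExtensionPast_of_eHomBesovNorm_bounded_of_albritton_besov_blowup_pathSpace
    (hA : ∀ ⦃ν : ℝ⦄, 0 < ν → ∀ ⦃p q : ℝ≥0∞⦄ [Fact (1 ≤ p)], 3 < p → p < ∞ → 3 < q → q < ∞ →
      ∀ ⦃T : ℝ⦄, 0 < T → ∀ ⦃u : ℝ → EuclideanSpace ℝ (Fin 3) → EuclideanSpace ℝ (Fin 3)⦄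
        ⦃U : ℝ → 𝓢'(EuclideanSpace ℝ (Fin 3), EuclideanSpace ℂ (Fin 3))⦄,
        IsMaximalGKPSolution p q T ν u U →
          Tendsto (fun t => FunctionSpaces.eHomBesovNorm (-1 + 3 / p.toReal) p q (U t))
            (𝓝[<] T) (𝓝 ∞)) :
    hasSmoothExtensionPast_of_eHomBesovNorm_bounded :=
  hasSmoothExtensionPast_of_eHomBesovNorm_bounded_of_gkp_besov_blowup_pathSpace
    fun _ hν _ _ _ hp₃ hp hq₃ hq _ hT _ _ hmax => (hA hν hp₃ hp hq₃ hq hT hmax).limsup_eq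

/-- **Disjunctive record**: either faithful blow-up criterion over GKP's class — GKP Thm. 1
(`limsup` form) or Albritton Thm. 1.1 (limit form) — gives the continuation criterion.
[cite: GKP2016, Thm. 1] -/
theorem hasSmoothExtensionPast_of_eHomBesovNorm_bounded_of_pathSpace_blowup_or_tendsto
    (h : (∀ ⦃ν : ℝ⦄, 0 < ν → ∀ ⦃p q : ℝ≥0∞⦄ [Fact (1 ≤ p)], 3 < p → p < ∞ → 3 < q → q < ∞ →
      ∀ ⦃T : ℝ⦄, 0 < T → ∀ ⦃u : ℝ → EuclideanSpace ℝ (Fin 3) → EuclideanSpace ℝ (Fin 3)⦄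
        ⦃U : ℝ → 𝓢'(EuclideanSpace ℝ (Fin 3), EuclideanSpace ℂ (Fin 3))⦄,
        IsMaximalGKPSolution p q T ν u U →
          limsup (fun t => FunctionSpaces.eHomBesovNorm (-1 + 3 / p.toReal) p q (U t))
            (𝓝[<] T) = ∞) ∨
      (∀ ⦃ν : ℝ⦄, 0 < ν → ∀ ⦃p q : ℝ≥0∞⦄ [Fact (1 ≤ p)], 3 < p → p < ∞ → 3 < q → q < ∞ →
      ∀ ⦃T : ℝ⦄, 0 < T → ∀ ⦃u : ℝ → EuclideanSpace ℝ (Fin 3) → EuclideanSpace ℝ (Fin 3)⦄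
        ⦃U : ℝ → 𝓢'(EuclideanSpace ℝ (Fin 3), EuclideanSpace ℂ (Fin 3))⦄,
        IsMaximalGKPSolution p q T ν u U →
          Tendsto (fun t => FunctionSpaces.eHomBesovNorm (-1 + 3 / p.toReal) p q (U t))
            (𝓝[<] T) (𝓝 ∞))) :
    hasSmoothExtensionPast_of_eHomBesovNorm_bounded :=
  h.elim hasSmoothExtensionPast_of_eHomBesovNorm_bounded_of_gkp_besov_blowup_pathSpace
    hasSmoothExtensionPast_of_eHomBesovNorm_bounded_of_albritton_besov_blowup_pathSpace

end Literature.Analysis.FluidPDE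

end
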